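/-
Copyright: statement-level skeleton of a published paper (lit-balaban cell, Phase-2 proof seat p39 gen 12). No proof claims
beyond what the kernel checks below.
-/
import Literature.MathematicalPhysics.QuantumFieldTheory.Balaban1983to89.B3WT226FreeGaussian
import Literature.MathematicalPhysics.QuantumFieldTheory.Balaban1983to89.B3WT226PeriodicLimit
import Mathlib.MeasureTheory.Measure.LevyConvergence

/-!
# B3 — T. Bałaban, *(Higgs)₂,₃ quantum fields in a finite volume. III. Renormalization*, CMP **88** (1983) 411–445
[Balaban1983Higgs3], (2.25)/(2.26) p. 431 [PDF 21]: **THE GAUSSIAN MEASURES WITH PERIODIC BOUNDARY CONDITIONS AND THEIR PERIODIC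
EXTENSIONS TO `ηℤ^d`** — the torus Green's function `C_T = η^{−d}(−Δ^η_T + M²)^{−1}` on `(ℤ/Nℤ)^d` (positive definite), the torus
Gaussian measure `dμ_{C_T}`, and the `N`-periodic Gaussian field `dμ_{C_N}` on `ηℤ^d` (covariance `δ_{ab}C_N(x − y)`, `C_N` the
periodization of `C^η_{M²}`) = the torus field read periodically; the measures between which p. 431 passes *"by taking a limit of
the identities with periodic boundary conditions"*.

statement-level skeleton of published theorems with citation tags; proofs where landed; nothing here is a claim about
the Yang–Mills mass gap

PDF held: `paper:balaban1983-higgs-2-3-quantum-fields-finite-volume` (journal page = PDF page + 410); p. 431 [PDF 21] re-read for this file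
(`lit read … --pages 17-25`, text layer `p0021.txt`).

CITATION HEADER (lean-in-tree rule).  Part of the lit-balaban TYPED SKELETON (HOME `run/shared/lean/pub/lit-balaban/`), PHASE 2,
proof seat p39 (generation 12).  Rows **B3.Eq2.24-2.25** / **B3.Eq2.26-2.28** of `HOME/lit-balaban-r15/ROWS-B3.md` (fold owner r15).
Builds on this seat's gen-11 files `B3WT226PeriodicKernel` (the torus `(ℤ/Nℤ)^d`: `TSite`, `negLapT`, the torus identity
`bracketT_eq_zero`), `B3WT226PeriodicLimit` (`proj`, the periodization `perC`, `CT`, `negLapT_CT_add`, `tendsto_perC`,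
`bracketFin_perC_eq_zero`, `tendsto_bracketFin`) and gen-12 files `B3WTFreeMeasure` (Kolmogorov extension `gaussianFieldOfKernel`,
Wick), `B3WTFreeWick` (`scalarKernel`/`kernelMeasure`: the Gaussian field of any positive semidefinite `δ_{ab}C(x − y)`),
`B3WT226FreeGaussian` (the (2.26) integrand and its Wick evaluation `eq226_free_wick_bracketK` for every such kernel).

THE PRINTED TEXT (verbatim, p. 431 [PDF 21]): *"Taking F = 1, differentiating with respect to A and next taking A = 0 and using the
identity (2.25), we get ∫dμ_{C^η_{M²}}(φ)[(−e_k⟨∂^ηφ,Aqφ⟩)(:⟨∂^ηφ,∂^ηλqφ⟩:) − e_k⟨φ,A·∂^ηλq²φ⟩ − e_k⟨∂^ηφ,ηA∂^ηλq²φ⟩] = … = 0, (2.26)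
… They hold for free boundary conditions also by taking a limit of the identities with periodic boundary conditions."*  The
identities "with periodic boundary conditions" are Gaussian integrals over the torus measure `dμ_{C_T}`, `C_T` the torus propagator
`(−Δ^η_T + M²)^{−1}` (kernel normalized by `η^{−d}δ`); read on the infinite lattice through `x ↦ proj x` they are integrals over the
`L`-periodic Gaussian field `dμ_{C_L}`, `C_L(z) = Σ_{n∈ℤ^d}C^η_{M²}(z + Ln)`; the "limit" is `L → ∞`.

WHAT IS TYPED / PROVED (`d`, `N` (colours) arbitrary; period `L ≥ 1`; `η > 0`, `M² > 0`).
* §1 the torus operator: `sum_mul_negLapT` (polarized Dirichlet form, summation by parts), `opT`/`KT` (the matrix of `−Δ^η_T + M²`),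
  `KT_isHermitian`, **`KT_posDef`**; the Green's matrix `GT(s,t) = C_T(s − t)` of the periodized propagator, **`KT_mul_GT`**
  (`K_TG_T = η^{−d}·1`, from `negLapT_CT_add`), **`GT_eq_smul_inv`** (`C_T = η^{−d}K_T^{−1}`: THE PERIODIZED INFINITE-VOLUME PROPAGATOR
  IS THE TORUS GREEN'S FUNCTION), `GT_posDef`;
* §2 positive semidefiniteness: `sum_sum_mul_mul_eq_dotProduct` (regrouping along a map), `sum_sum_mul_mul_CT_nonneg`,
  `sum_sum_mul_mul_perC_nonneg` (pull-back along `proj`), **`isPosSemidefKernel_periodic`** (`δ_{ab}C_L(x − y)` on `ℤ^d × Fin N`),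
  `torusKernel`, **`isPosSemidefKernel_torusKernel`**;
* §3 the measures: **`torusMeasure d N L η M²`** (`dμ_{C_T}`: probability, centred Gaussian, `covariance_eval_torusMeasure`,
  **`covariance_eval_torusMeasure_eq_inv`** (`Cov(φ_a(s),φ_b(t)) = δ_{ab}η^{−d}(K_T^{−1})(s,t)`), uniqueness), **`periodicMeasure d N L η M²`**
  (`dμ_{C_L}` on `ℤ^d`, an instance of `kernelMeasure`; probability, Gaussian, centred, covariance `δ_{ab}C_L(x − y)`), `pullT` and
  **`map_pullT_torusMeasure`** (`dμ_{C_L}` IS `dμ_{C_T}` read periodically: the push-forward along `ω_T ↦ ω_T ∘ proj`);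
* §4 the limit: `integrand226`/`lhs226` (the printed left member as a functional of the measure), `eq225_periodic` ((2.25) under
  `dμ_{C_L}`), **`lhs226_periodic_eq_integral_torus`** (the periodic left member is a torus Gaussian integral), **`lhs226_periodic_eq`**
  (Wick under `dμ_{C_L}`: `= eΣ_bη^dB_b tr q²·bracket226 η C_L λ b`), **`lhs226_periodic_eq_zero`** (it VANISHES for every period
  `L ≥ 2 + 2·(diameter data)` — the torus identities), **`tendsto_lhs226_periodic`** (it CONVERGES to the free left member as `L → ∞`),
  and **`lhs226_free_eq_zero_of_periodic_limit`** — (2.26) at free boundary conditions, Gaussian left member, obtained literally *"by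
  taking a limit of the identities with periodic boundary conditions"* (finitely supported `λ`);
* §5 (v1.1) the measure-level limit: `marginalLaw` (window marginals on `EuclideanSpace ℝ I`), **`marginalLaw_gaussianFieldOfKernel`**
  (`= multivariateGaussian 0 (covGram K I)`), `tendsto_charFun_marginalLaw_periodic`, and **`tendsto_marginal_periodic`**: EVERY
  FINITE-DIMENSIONAL MARGINAL of `dμ_{C_{L+1}}` CONVERGES WEAKLY to that of `dμ_{C^η_{M²}}` as `L → ∞` (Lévy's continuity theorem,
  `C_L → C^η_{M²}` pointwise).
HONEST SCOPE: (i) the torus here is the cubic `(ℤ/Lℤ)^d` of `B3WT226PeriodicKernel` (one period `L`), not the model's anisotropic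
`HiggsLattice.Site` (periods `2L^{K−k}ML′_μ`); the torus measure is characterized by its covariance `η^{−d}(−Δ^η_T + M²)^{−1} ⊗ 1_N`
(uniqueness of centred Gaussian measures), its identification with the density form `Z^{−1}exp[−½⟨φ,(−Δ^η_{A=0} + M²)φ⟩]dφ` of
(2.23)–(2.24) is the model-torus chain `B3WT223Instance`/`B3WTCovariance`, not re-derived on `(ℤ/Lℤ)^d`; (ii) convergence of the
measures is proved for all finite-dimensional marginals (§5, weak convergence) and for the printed Gaussian left member (§4, a
polynomial cylinder functional — not bounded continuous, so §4 is proved by Wick, not deduced from §5); (iii) the periodic identities are obtained from the torus kernel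
identity of gen 11 through the Wick evaluation, the `A`-derivative derivation of (2.26) from (2.24) stays on the model torus (gen 3).
Mathlib + the cited tree files only; definitions with bodies and theorems, no named fact, no `sorry`; standard axioms.  Unit
`lit-balaban-p39-g12`, HOME `run/shared/lean/pub/lit-balaban/`, 2026-08-22.

References: [Balaban1983Higgs3] CMP 88 (1983), (2.23)–(2.26) pp. 430–431; [Kallenberg2002] O. Kallenberg, *Foundations of Modern
Probability*, Lemma 13.1; [Janson1997] S. Janson, *Gaussian Hilbert Spaces*, Thm 1.28.
-/

noncomputable section

open scoped BigOperators InnerProductSpace Matrix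
open MeasureTheory ProbabilityTheory Finset Filter Topology

namespace Literature.MathematicalPhysics.QuantumFieldTheory.Balaban1983to89.B3WTPeriodicMeasure

open B3Sect3VectorSelfEnergy B3CxiPropagator B3WT226FreeLattice B3WT226PeriodicKernel B3WT226PeriodicLimit
open B3WTFreeMeasure B3WTFreeWick B3WT226FreeGaussian
open B3WTCovariance (trE)
open Literature.MathematicalPhysics.QuantumFieldTheory

variable {d N L : ℕ}

/-! ## §1 The torus operator `−Δ^η_T + M²` on `(ℤ/Nℤ)^d`: Dirichlet form, symmetry, positivity, and its Green's function
`C_T = η^{−d}(−Δ^η_T + M²)^{−1}` — the periodized propagator of `B3WT226PeriodicLimit.CT` IS the inverse -/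

section TorusOperator

variable {η M2 : ℝ}

/-- the polarized Dirichlet form of `−Δ^η_T`: `Σ_t g(t)(−Δ^η_Tf)(t) = Σ_μ η^{−2}Σ_t (f(t+e_μ) − f(t))(g(t+e_μ) − g(t))` (summation by
parts on the torus). [cite: Balaban1983Higgs3, (2.23) p.430] -/
theorem sum_mul_negLapT [NeZero L] (f g : TSite d L → ℝ) :
    ∑ t, g t * negLapT η f t = ∑ μ : Fin d, η⁻¹ ^ 2 * ∑ t, (f (t + unitVecT μ) - f t) * (g (t + unitVecT μ) - g t) := by
  have shift : ∀ (μ : Fin d) (h : TSite d L → ℝ), ∑ t, h (t + unitVecT μ) = ∑ t, h t := fun μ h =>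
    Fintype.sum_equiv (Equiv.addRight (unitVecT μ)) _ _ fun t => rfl
  have hL : ∑ t, g t * negLapT η f t =
      ∑ μ : Fin d, η⁻¹ ^ 2 * ∑ t, g t * (2 * f t - f (t + unitVecT μ) - f (t - unitVecT μ)) := by
    simp only [negLapT, Finset.mul_sum]
    rw [Finset.sum_comm]
    refine Finset.sum_congr rfl fun μ _ => Finset.sum_congr rfl fun t _ => ?_
    ring
  rw [hL]
  refine Finset.sum_congr rfl fun μ _ => ?_
  congr 1
  have h1 : ∑ t, g t * f (t - unitVecT μ) = ∑ t, g (t + unitVecT μ) * f t := by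
    rw [← shift μ (fun t => g t * f (t - unitVecT μ))]
    simp only [add_sub_cancel_right]
  have h2 : ∑ t, f (t + unitVecT μ) * g (t + unitVecT μ) = ∑ t, f t * g t := shift μ (fun t => f t * g t)
  have eL : ∑ t, g t * (2 * f t - f (t + unitVecT μ) - f (t - unitVecT μ)) =
      2 * ∑ t, f t * g t - ∑ t, g t * f (t + unitVecT μ) - ∑ t, g (t + unitVecT μ) * f t := by
    rw [← h1, Finset.mul_sum, ← Finset.sum_sub_distrib, ← Finset.sum_sub_distrib]
    refine Finset.sum_congr rfl fun t _ => ?_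
    ring
  have eR : ∑ t, (f (t + unitVecT μ) - f t) * (g (t + unitVecT μ) - g t) =
      ∑ t, f (t + unitVecT μ) * g (t + unitVecT μ) + ∑ t, f t * g t - ∑ t, g t * f (t + unitVecT μ) -
        ∑ t, g (t + unitVecT μ) * f t := by
    rw [← Finset.sum_add_distrib, ← Finset.sum_sub_distrib, ← Finset.sum_sub_distrib]
    refine Finset.sum_congr rfl fun t _ => ?_
    ring
  rw [eL, eR, h2]
  ring

/-- `−Δ^η_T` is symmetric: `Σ_t g(−Δ^η_Tf) = Σ_t f(−Δ^η_Tg)`. [cite: Balaban1983Higgs3, (2.23) p.430] -/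
theorem sum_mul_negLapT_comm [NeZero L] (f g : TSite d L → ℝ) : ∑ t, g t * negLapT η f t = ∑ t, f t * negLapT η g t := by
  rw [sum_mul_negLapT, sum_mul_negLapT]
  refine Finset.sum_congr rfl fun μ _ => ?_
  congr 1
  exact Finset.sum_congr rfl fun t _ => mul_comm _ _

/-- the Dirichlet form: `Σ_t f(−Δ^η_Tf) = Σ_μ η^{−2}Σ_t (f(t+e_μ) − f(t))² ≥ 0`. [cite: Balaban1983Higgs3, (2.23) p.430] -/
theorem sum_mul_negLapT_self_nonneg [NeZero L] (f : TSite d L → ℝ) : 0 ≤ ∑ t, f t * negLapT η f t := by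
  rw [sum_mul_negLapT]
  exact Finset.sum_nonneg fun μ _ => mul_nonneg (sq_nonneg _) (Finset.sum_nonneg fun t _ => mul_self_nonneg _)

/-- the torus operator `−Δ^η_T + M²` as a linear map on `ℝ^{(ℤ/Nℤ)^d}`. [cite: Balaban1983Higgs3, (2.23) p.430] -/
def opT (η M2 : ℝ) : (TSite d L → ℝ) →ₗ[ℝ] (TSite d L → ℝ) where
  toFun f t := negLapT η f t + M2 * f t
  map_add' f g := by
    funext t
    simp only [Pi.add_apply, negLapT]
    have h : ∑ μ : Fin d, η⁻¹ ^ 2 * (2 * (f t + g t) - (f (t + unitVecT μ) + g (t + unitVecT μ)) -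
        (f (t - unitVecT μ) + g (t - unitVecT μ))) =
        ∑ μ : Fin d, η⁻¹ ^ 2 * (2 * f t - f (t + unitVecT μ) - f (t - unitVecT μ)) +
          ∑ μ : Fin d, η⁻¹ ^ 2 * (2 * g t - g (t + unitVecT μ) - g (t - unitVecT μ)) := by
      rw [← Finset.sum_add_distrib]
      exact Finset.sum_congr rfl fun μ _ => by ring
    rw [h]
    ring
  map_smul' c f := by
    funext t
    simp only [Pi.smul_apply, smul_eq_mul, RingHom.id_apply, negLapT]
    have h : ∑ μ : Fin d, η⁻¹ ^ 2 * (2 * (c * f t) - c * f (t + unitVecT μ) - c * f (t - unitVecT μ)) =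
        c * ∑ μ : Fin d, η⁻¹ ^ 2 * (2 * f t - f (t + unitVecT μ) - f (t - unitVecT μ)) := by
      rw [Finset.mul_sum]
      exact Finset.sum_congr rfl fun μ _ => by ring
    rw [h]
    ring

/-- unfolding. [cite: Balaban1983Higgs3, (2.23) p.430] -/
@[simp] theorem opT_apply (f : TSite d L → ℝ) (t : TSite d L) : opT η M2 f t = negLapT η f t + M2 * f t := rfl

/-- **the matrix `K_T` of `−Δ^η_T + M²`** in the site basis. [cite: Balaban1983Higgs3, (2.23) p.430] -/
def KT (L : ℕ) [NeZero L] (η M2 : ℝ) : Matrix (TSite d L) (TSite d L) ℝ := LinearMap.toMatrix' (opT (d := d) (L := L) η M2)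

/-- `K_T f = (−Δ^η_T + M²)f`. [cite: Balaban1983Higgs3, (2.23) p.430] -/
theorem KT_mulVec [NeZero L] (f : TSite d L → ℝ) : KT (d := d) L η M2 *ᵥ f = fun t => negLapT η f t + M2 * f t := by
  rw [KT, LinearMap.toMatrix'_mulVec]
  rfl

/-- the quadratic form of `K_T`: `⟨f, K_Tf⟩ = Σ_t f(−Δ^η_Tf) + M²Σ_t f²`. [cite: Balaban1983Higgs3, (2.23) p.430] -/
theorem dotProduct_KT_mulVec [NeZero L] (f : TSite d L → ℝ) :
    f ⬝ᵥ (KT (d := d) L η M2 *ᵥ f) = ∑ t, f t * negLapT η f t + M2 * ∑ t, f t ^ 2 := by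
  rw [KT_mulVec, dotProduct, Finset.mul_sum, ← Finset.sum_add_distrib]
  exact Finset.sum_congr rfl fun t _ => by ring

/-- the entries of `K_T`: `K_T(s,t) = ((−Δ^η_T + M²)δ_t)(s)`. [cite: Balaban1983Higgs3, (2.23) p.430] -/
theorem KT_apply [NeZero L] (s t : TSite d L) :
    KT (d := d) L η M2 s t = opT η M2 (fun t' => if t' = t then 1 else 0) s := by
  rw [KT, LinearMap.toMatrix'_apply]
  have h : (Pi.single t (1 : ℝ) : TSite d L → ℝ) = fun t' => if t' = t then 1 else 0 := by
    funext t'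
    simp [Pi.single_apply]
  rw [h]

/-- `K_T` is symmetric. [cite: Balaban1983Higgs3, (2.23) p.430] -/
theorem KT_isHermitian [NeZero L] : (KT (d := d) L η M2).IsHermitian := by
  refine Matrix.IsHermitian.ext fun s t => ?_
  rw [star_trivial, KT_apply, KT_apply]
  have key : ∀ a b : TSite d L, opT η M2 (fun t' => if t' = b then (1 : ℝ) else 0) a =
      ∑ t', (if t' = a then (1 : ℝ) else 0) * opT η M2 (fun t' => if t' = b then (1 : ℝ) else 0) t' := fun a b => by
    rw [Finset.sum_eq_single a (fun t' _ ht' => by rw [if_neg ht', zero_mul]) (by simp)]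
    rw [if_pos rfl, one_mul]
  rw [key t s, key s t]
  simp only [opT_apply, mul_add, Finset.sum_add_distrib]
  congr 1
  · exact sum_mul_negLapT_comm _ _
  · exact Finset.sum_congr rfl fun t' _ => by ring

/-- **`−Δ^η_T + M²` IS POSITIVE DEFINITE on the torus** for `M² > 0`. [cite: Balaban1983Higgs3, (2.23) p.430] -/
theorem KT_posDef [NeZero L] (hM : 0 < M2) : (KT (d := d) L η M2).PosDef := by
  refine Matrix.PosDef.of_dotProduct_mulVec_pos KT_isHermitian fun x hx => ?_
  rw [star_trivial, dotProduct_KT_mulVec]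
  have hsq : 0 < ∑ t, x t ^ 2 := by
    obtain ⟨t₀, ht₀⟩ : ∃ t₀, x t₀ ≠ 0 := Function.ne_iff.mp hx
    exact lt_of_lt_of_le (by positivity) (Finset.single_le_sum (fun t _ => sq_nonneg (x t)) (Finset.mem_univ t₀))
  have h0 := sum_mul_negLapT_self_nonneg (η := η) x
  nlinarith

/-- **the torus Green's matrix**: `G_T(s,t) = C_T(s − t)`, `C_T` the periodized infinite-volume propagator of
`B3WT226PeriodicLimit.CT`. [cite: Balaban1983Higgs3, (2.26) p.431] -/
def GT (L : ℕ) [NeZero L] (η M2 : ℝ) : Matrix (TSite d L) (TSite d L) ℝ :=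
  Matrix.of fun s t => CT L (CetaM d η M2) (s - t)

/-- unfolding. [cite: Balaban1983Higgs3, (2.26) p.431] -/
theorem GT_apply [NeZero L] (s t : TSite d L) : GT (d := d) L η M2 s t = CT L (CetaM d η M2) (s - t) := rfl

/-- `−Δ^η_T` commutes with translations. [cite: Balaban1983Higgs3, (2.23) p.430] -/
theorem negLapT_translate (g : TSite d L → ℝ) (u s : TSite d L) :
    negLapT η (fun t => g (t - u)) s = negLapT η g (s - u) := by
  simp only [negLapT, add_sub_right_comm, sub_right_comm s _ u]

/-- **`K_T G_T = η^{−d}·1`**: the periodized propagator solves the torus equation `(−Δ^η_T + M²)C_T = δ^η_T` (gen 11,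
`negLapT_CT_add`), column by column. [cite: Balaban1983Higgs3, (2.26) p.431] -/
theorem KT_mul_GT [NeZero L] (hη : 0 < η) (hM : 0 < M2) (hL : 1 ≤ L) :
    KT (d := d) L η M2 * GT L η M2 = (η⁻¹ ^ d) • (1 : Matrix (TSite d L) (TSite d L) ℝ) := by
  ext s u
  rw [Matrix.mul_apply]
  have hcol : ∑ x, KT (d := d) L η M2 s x * GT L η M2 x u = (KT (d := d) L η M2 *ᵥ fun t => GT L η M2 t u) s := rfl
  rw [hcol, KT_mulVec]
  simp only [GT_apply]
  rw [negLapT_translate, negLapT_CT_add (m := 1) (summable_weight_CetaM hη hM 1) hL (negLapZ_CetaM_add hη hM) (s - u),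
    Matrix.smul_apply, Matrix.one_apply, smul_eq_mul]
  by_cases hsu : s = u
  · rw [if_pos (sub_eq_zero.2 hsu), if_pos hsu, mul_one]
  · rw [if_neg (fun h => hsu (sub_eq_zero.1 h)), if_neg hsu, mul_zero]

/-- **`C_T = η^{−d}(−Δ^η_T + M²)^{−1}`**: the torus Green's matrix is `η^{−d}` times the inverse of `K_T`. [cite: Balaban1983Higgs3, (2.26) p.431] -/
theorem GT_eq_smul_inv [NeZero L] (hη : 0 < η) (hM : 0 < M2) (hL : 1 ≤ L) :
    GT (d := d) L η M2 = (η⁻¹ ^ d) • (KT (d := d) L η M2)⁻¹ := by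
  have hc : (η⁻¹ ^ d : ℝ) ≠ 0 := pow_ne_zero _ (inv_ne_zero hη.ne')
  have h1 : KT (d := d) L η M2 * ((η⁻¹ ^ d)⁻¹ • GT L η M2) = 1 := by
    rw [Matrix.mul_smul, KT_mul_GT hη hM hL, smul_smul, inv_mul_cancel₀ hc, one_smul]
  rw [Matrix.inv_eq_right_inv h1, smul_smul, mul_inv_cancel₀ hc, one_smul]

/-- **the torus Green's matrix is positive definite** (inverse of a positive definite matrix, times `η^{−d} > 0`).
[cite: Balaban1983Higgs3, (2.26) p.431] -/
theorem GT_posDef [NeZero L] (hη : 0 < η) (hM : 0 < M2) (hL : 1 ≤ L) : (GT (d := d) L η M2).PosDef := by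
  rw [GT_eq_smul_inv hη hM hL]
  exact (KT_posDef hM).inv.smul (pow_pos (inv_pos.2 hη) d)

/-- the quadratic form of the torus Green's matrix is nonnegative. [cite: Balaban1983Higgs3, (2.26) p.431] -/
theorem dotProduct_GT_mulVec_nonneg [NeZero L] (hη : 0 < η) (hM : 0 < M2) (hL : 1 ≤ L) (v : TSite d L → ℝ) :
    0 ≤ v ⬝ᵥ (GT (d := d) L η M2 *ᵥ v) := by
  have h := (GT_posDef (d := d) (L := L) hη hM hL).posSemidef.dotProduct_mulVec_nonneg v
  rwa [star_trivial] at h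

end TorusOperator

/-! ## §2 Positive semidefiniteness of the torus kernel `δ_{ab}C_T(s − t)` and of the periodic kernel `δ_{ab}C_L(x − y)` on `ℤ^d` -/

section Kernels

variable [NeZero L] {η M2 : ℝ}

/-- regrouping a double sum along a map into a quadratic form: `Σ_{jj′}c_jc_{j′}G(πj, πj′) = ⟨v, Gv⟩`, `v(t) = Σ_{πj = t}c_j`.
[cite: Kallenberg2002, Lemma 13.1] -/
theorem sum_sum_mul_mul_eq_dotProduct {T : Type*} [Fintype T] [DecidableEq T] (G : Matrix T T ℝ) {J : Type*} [Fintype J]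
    (π : J → T) (c : J → ℝ) :
    ∑ j, ∑ j', c j * c j' * G (π j) (π j') =
      (fun t => ∑ j, if π j = t then c j else 0) ⬝ᵥ (G *ᵥ fun t => ∑ j, if π j = t then c j else 0) := by
  simp only [dotProduct, Matrix.mulVec]
  have hcol : ∀ s : T, (∑ t, G s t * ∑ j', (if π j' = t then c j' else 0)) = ∑ j', G s (π j') * c j' := by
    intro s
    calc (∑ t, G s t * ∑ j', (if π j' = t then c j' else 0))
        = ∑ t, ∑ j', G s t * (if π j' = t then c j' else 0) :=
          Finset.sum_congr rfl fun t _ => by rw [Finset.mul_sum]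
      _ = ∑ j', ∑ t, G s t * (if π j' = t then c j' else 0) := Finset.sum_comm
      _ = ∑ j', G s (π j') * c j' := Finset.sum_congr rfl fun j' _ => by
          rw [Finset.sum_eq_single (π j') (fun t _ ht => by rw [if_neg (Ne.symm ht), mul_zero]) (by simp), if_pos rfl]
  simp_rw [hcol]
  calc ∑ j, ∑ j', c j * c j' * G (π j) (π j')
      = ∑ j, c j * ∑ j', G (π j) (π j') * c j' := by
        refine Finset.sum_congr rfl fun j _ => ?_
        rw [Finset.mul_sum]
        exact Finset.sum_congr rfl fun j' _ => by ring
    _ = ∑ j, ∑ s, (if π j = s then c j else 0) * ∑ j', G s (π j') * c j' := by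
        refine Finset.sum_congr rfl fun j _ => ?_
        rw [Finset.sum_eq_single (π j) (fun s _ hs => by rw [if_neg (Ne.symm hs), zero_mul]) (by simp), if_pos rfl]
    _ = ∑ s, ∑ j, (if π j = s then c j else 0) * ∑ j', G s (π j') * c j' := Finset.sum_comm
    _ = ∑ s, (∑ j, if π j = s then c j else 0) * ∑ j', G s (π j') * c j' :=
        Finset.sum_congr rfl fun s _ => by rw [Finset.sum_mul]

/-- **the torus propagator is positive semidefinite along finite families**: `Σ_{jj′}c_jc_{j′}C_T(g_j − g_{j′}) ≥ 0`.
[cite: Balaban1983Higgs3, (2.26) p.431] -/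
theorem sum_sum_mul_mul_CT_nonneg (hη : 0 < η) (hM : 0 < M2) (hL : 1 ≤ L) (J : Type) [Fintype J] (g : J → TSite d L)
    (c : J → ℝ) : 0 ≤ ∑ j, ∑ j', c j * c j' * CT L (CetaM d η M2) (g j - g j') := by
  have h : ∀ j j', CT L (CetaM d η M2) (g j - g j') = GT (d := d) L η M2 (g j) (g j') := fun j j' => rfl
  simp_rw [h]
  rw [sum_sum_mul_mul_eq_dotProduct]
  exact dotProduct_GT_mulVec_nonneg hη hM hL _

/-- **the periodized propagator `C_L` is positive semidefinite along finite families of sites of `ℤ^d`** (pull-back of the torus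
Green's matrix along `proj`). [cite: Balaban1983Higgs3, (2.26) p.431] -/
theorem sum_sum_mul_mul_perC_nonneg (hη : 0 < η) (hM : 0 < M2) (hL : 1 ≤ L) (J : Type) [Fintype J] (g : J → ZSite d)
    (c : J → ℝ) : 0 ≤ ∑ j, ∑ j', c j * c j' * perC L (CetaM d η M2) (g j - g j') := by
  have h : ∀ j j', perC L (CetaM d η M2) (g j - g j') = GT (d := d) L η M2 (proj L (g j)) (proj L (g j')) := by
    intro j j'
    rw [GT_apply, ← proj_sub, CT_proj]
  simp_rw [h]
  rw [sum_sum_mul_mul_eq_dotProduct]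
  exact dotProduct_GT_mulVec_nonneg hη hM hL _

/-- **the periodic kernel `δ_{ab}C_L(x − y)` on `ℤ^d × {1,…,N}` is positive semidefinite** (`L ≥ 1`, `η > 0`, `M² > 0`).
[cite: Kallenberg2002, Lemma 13.1] -/
theorem isPosSemidefKernel_periodic (hη : 0 < η) (hM : 0 < M2) (hL : 1 ≤ L) :
    IsPosSemidefKernel (scalarKernel d N (perC L (CetaM d η M2))) :=
  isPosSemidefKernel_scalarKernel (perC_neg CetaM_neg L) (sum_sum_mul_mul_perC_nonneg hη hM hL)

/-- indices `(t, a)` of the torus field: site of `(ℤ/Lℤ)^d` and colour. [cite: Balaban1983Higgs3, (2.23) p.430] -/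
abbrev TIdx (d N L : ℕ) : Type := TSite d L × Fin N

/-- configurations of the torus field `ω_T(t, a) = φ_a(t)`. [cite: Balaban1983Higgs3, (2.23) p.430] -/
abbrev TCfg (d N L : ℕ) : Type := TIdx d N L → ℝ

/-- **the covariance kernel of the torus Gaussian measure**: `δ_{ab}C_T(s − t)`. [cite: Balaban1983Higgs3, (2.26) p.431] -/
def torusKernel (d N L : ℕ) [NeZero L] (η M2 : ℝ) (p q : TIdx d N L) : ℝ :=
  if p.2 = q.2 then CT L (CetaM d η M2) (p.1 - q.1) else 0

/-- unfolding. [cite: Balaban1983Higgs3, (2.26) p.431] -/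
theorem torusKernel_apply (p q : TIdx d N L) :
    torusKernel d N L η M2 p q = if p.2 = q.2 then CT L (CetaM d η M2) (p.1 - q.1) else 0 := rfl

/-- the torus kernel is symmetric. [cite: Balaban1983Higgs3, (2.26) p.431] -/
theorem torusKernel_comm (p q : TIdx d N L) : torusKernel d N L η M2 p q = torusKernel d N L η M2 q p := by
  unfold torusKernel
  by_cases h : p.2 = q.2
  · rw [if_pos h, if_pos h.symm, ← CT_neg CetaM_neg, neg_sub]
  · rw [if_neg h, if_neg (Ne.symm h)]

/-- **the torus kernel is positive semidefinite**. [cite: Kallenberg2002, Lemma 13.1] -/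
theorem isPosSemidefKernel_torusKernel (hη : 0 < η) (hM : 0 < M2) (hL : 1 ≤ L) :
    IsPosSemidefKernel (torusKernel d N L η M2) := by
  intro I
  refine Matrix.PosSemidef.of_dotProduct_mulVec_nonneg (Matrix.IsHermitian.ext fun s t => ?_) fun x => ?_
  · simp only [covGram_apply, star_trivial]
    exact torusKernel_comm _ _
  · rw [star_trivial]
    have expand : x ⬝ᵥ (covGram (torusKernel d N L η M2) I *ᵥ x) =
        ∑ j : I, ∑ j' : I, x j * x j' *
          (if (j : TIdx d N L).2 = (j' : TIdx d N L).2 then CT L (CetaM d η M2) ((j : TIdx d N L).1 - (j' : TIdx d N L).1)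
            else 0) := by
      simp only [dotProduct, Matrix.mulVec, covGram_apply, torusKernel_apply, Finset.mul_sum]
      refine Finset.sum_congr rfl fun j _ => Finset.sum_congr rfl fun j' _ => ?_
      ring
    rw [expand]
    exact sum_sum_mul_mul_ite_nonneg (fun s t : TSite d L => CT L (CetaM d η M2) (s - t)) (sum_sum_mul_mul_CT_nonneg hη hM hL)
      (fun j : I => (j : TIdx d N L).1) (fun j : I => (j : TIdx d N L).2) x

end Kernels

/-! ## §3 The torus Gaussian measure `dμ_{C_T}` (periodic boundary conditions) and the `L`-periodic Gaussian field `dμ_{C_L}` on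
`ηℤ^d`; the latter is the former read periodically -/

section Measures

variable [NeZero L] {η M2 : ℝ}

/-- **the Gaussian measure with PERIODIC boundary conditions** `dμ_{C_T}` on the torus field configurations
`ω_T : (ℤ/Lℤ)^d × Fin N → ℝ`: centred, covariance `δ_{ab}C_T(s − t) = η^{−d}((−Δ^η_T + M²)^{−1})(s,t)δ_{ab}` — the normalized
`exp[−½⟨φ,(−Δ^η + M²)φ⟩]dφ` of (2.23)–(2.24) on the torus, as the Gaussian measure of its covariance. [cite: Balaban1983Higgs3, (2.24) p.430] -/
def torusMeasure (d N L : ℕ) [NeZero L] (η M2 : ℝ) : Measure (TCfg d N L) := gaussianFieldOfKernel (torusKernel d N L η M2)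

/-- `dμ_{C_T}` is a probability measure. [cite: Balaban1983Higgs3, (2.24) p.430] -/
theorem isProbabilityMeasure_torusMeasure (hη : 0 < η) (hM : 0 < M2) (hL : 1 ≤ L) :
    IsProbabilityMeasure (torusMeasure d N L η M2) :=
  isProbabilityMeasure_gaussianFieldOfKernel (isPosSemidefKernel_torusKernel hη hM hL)

/-- the torus field is a centred Gaussian process. [cite: Balaban1983Higgs3, (2.24) p.430] -/
theorem isGaussianProcess_torusMeasure (hη : 0 < η) (hM : 0 < M2) (hL : 1 ≤ L) :
    IsGaussianProcess (fun (p : TIdx d N L) (ω : TCfg d N L) => ω p) (torusMeasure d N L η M2) :=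
  isGaussianProcess_eval_gaussianFieldOfKernel (isPosSemidefKernel_torusKernel hη hM hL)

/-- `dμ_{C_T}` is centred. [cite: Balaban1983Higgs3, (2.24) p.430] -/
theorem integral_eval_torusMeasure (hη : 0 < η) (hM : 0 < M2) (hL : 1 ≤ L) (p : TIdx d N L) :
    ∫ ω, ω p ∂torusMeasure d N L η M2 = 0 :=
  integral_eval_gaussianFieldOfKernel (isPosSemidefKernel_torusKernel hη hM hL) p

/-- **the covariance of `dμ_{C_T}` is the torus propagator**: `Cov(φ_a(s), φ_b(t)) = δ_{ab}C_T(s − t)`. [cite: Balaban1983Higgs3, (2.26) p.431] -/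
theorem covariance_eval_torusMeasure (hη : 0 < η) (hM : 0 < M2) (hL : 1 ≤ L) (p q : TIdx d N L) :
    cov[fun ω => ω p, fun ω => ω q; torusMeasure d N L η M2] = torusKernel d N L η M2 p q :=
  covariance_eval_gaussianFieldOfKernel (isPosSemidefKernel_torusKernel hη hM hL) p q

/-- **… and the torus propagator is `η^{−d}(−Δ^η_T + M²)^{−1}`**: `Cov(φ_a(s), φ_b(t)) = δ_{ab}η^{−d}(K_T^{−1})(s,t)` — `dμ_{C_T}` IS the
centred Gaussian measure of covariance operator `η^{−d}(−Δ^η_T + M²)^{−1} ⊗ 1_N`, i.e. the normalized `exp[−½η^d⟨φ,(−Δ^η_T + M²)φ⟩]dφ`.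
[cite: Balaban1983Higgs3, (2.24) p.430] -/
theorem covariance_eval_torusMeasure_eq_inv (hη : 0 < η) (hM : 0 < M2) (hL : 1 ≤ L) (p q : TIdx d N L) :
    cov[fun ω => ω p, fun ω => ω q; torusMeasure d N L η M2] =
      if p.2 = q.2 then η⁻¹ ^ d * (KT (d := d) L η M2)⁻¹ p.1 q.1 else 0 := by
  rw [covariance_eval_torusMeasure hη hM hL, torusKernel_apply]
  have h : CT L (CetaM d η M2) (p.1 - q.1) = GT (d := d) L η M2 p.1 q.1 := rfl
  rw [h, GT_eq_smul_inv hη hM hL, Matrix.smul_apply, smul_eq_mul]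

/-- uniqueness of `dμ_{C_T}` among probability measures making the torus field a centred Gaussian process with covariance
`δ_{ab}C_T(s − t)`. [cite: Kallenberg2002, Lemma 13.1] -/
theorem eq_torusMeasure_of_isGaussianProcess (hη : 0 < η) (hM : 0 < M2) (hL : 1 ≤ L) {ν : Measure (TCfg d N L)}
    [IsProbabilityMeasure ν] (hG : IsGaussianProcess (fun (p : TIdx d N L) (ω : TCfg d N L) => ω p) ν)
    (hm : ∀ p, ∫ ω, ω p ∂ν = 0) (hc : ∀ p q, cov[fun ω => ω p, fun ω => ω q; ν] = torusKernel d N L η M2 p q) :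
    ν = torusMeasure d N L η M2 :=
  eq_gaussianFieldOfKernel_of_isGaussianProcess (isPosSemidefKernel_torusKernel hη hM hL) hG hm hc

/-- **the `L`-PERIODIC GAUSSIAN FIELD `dμ_{C_L}` ON `ηℤ^d`**: the centred Gaussian measure on `ω : ℤ^d × Fin N → ℝ` with covariance
`δ_{ab}C_L(x − y)`, `C_L = Σ_{n∈ℤ^d}C^η_{M²}(· + Ln)` the periodized propagator (`B3WT226PeriodicLimit.perC`) — the instance
`C = C_L` of `B3WTFreeWick.kernelMeasure`; the Gaussian integrals *"with periodic boundary conditions"* of p. 431 read on the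
infinite lattice. [cite: Balaban1983Higgs3, (2.26) p.431] -/
def periodicMeasure (d N L : ℕ) (η M2 : ℝ) : Measure (Cfg d N) := kernelMeasure d N (perC L (CetaM d η M2))

/-- `dμ_{C_L}` is a probability measure. [cite: Balaban1983Higgs3, (2.26) p.431] -/
theorem isProbabilityMeasure_periodicMeasure (hη : 0 < η) (hM : 0 < M2) (hL : 1 ≤ L) :
    IsProbabilityMeasure (periodicMeasure d N L η M2) :=
  isProbabilityMeasure_kernelMeasure (isPosSemidefKernel_periodic hη hM hL)

/-- the coordinate process is a centred Gaussian process under `dμ_{C_L}`. [cite: Balaban1983Higgs3, (2.26) p.431] -/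
theorem isGaussianProcess_periodicMeasure (hη : 0 < η) (hM : 0 < M2) (hL : 1 ≤ L) :
    IsGaussianProcess (fun (p : Idx d N) (ω : Cfg d N) => ω p) (periodicMeasure d N L η M2) :=
  isGaussianProcess_kernelMeasure (isPosSemidefKernel_periodic hη hM hL)

/-- `dμ_{C_L}` is centred. [cite: Balaban1983Higgs3, (2.26) p.431] -/
theorem integral_eval_periodicMeasure (hη : 0 < η) (hM : 0 < M2) (hL : 1 ≤ L) (p : Idx d N) :
    ∫ ω, ω p ∂periodicMeasure d N L η M2 = 0 :=
  integral_eval_kernelMeasure (isPosSemidefKernel_periodic hη hM hL) p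

/-- **the covariance of `dμ_{C_L}` is `δ_{ab}C_L(x − y)`**. [cite: Balaban1983Higgs3, (2.26) p.431] -/
theorem covariance_eval_periodicMeasure (hη : 0 < η) (hM : 0 < M2) (hL : 1 ≤ L) (p q : Idx d N) :
    cov[fun ω => ω p, fun ω => ω q; periodicMeasure d N L η M2] = scalarKernel d N (perC L (CetaM d η M2)) p q :=
  covariance_eval_kernelMeasure (isPosSemidefKernel_periodic hη hM hL) p q

/-- reading a torus configuration periodically on `ℤ^d`: `(Rω_T)(x, a) = ω_T(proj x, a)`. [cite: Balaban1983Higgs3, (2.26) p.431] -/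
def pullT (L : ℕ) (ωT : TCfg d N L) : Cfg d N := fun p => ωT (proj L p.1, p.2)

omit [NeZero L] in
/-- unfolding. [cite: Balaban1983Higgs3, (2.26) p.431] -/
@[simp] theorem pullT_apply (ωT : TCfg d N L) (p : Idx d N) : pullT L ωT p = ωT (proj L p.1, p.2) := rfl

omit [NeZero L] in
/-- the periodic reading is measurable. [cite: Balaban1983Higgs3, (2.26) p.431] -/
@[fun_prop]
theorem measurable_pullT : Measurable (pullT (d := d) (N := N) L) :=
  measurable_pi_lambda _ fun _ => measurable_pi_apply _

/-- **`dμ_{C_L}` IS THE TORUS MEASURE `dμ_{C_T}` READ PERIODICALLY**: the law of `x ↦ φ(proj x)` under `dμ_{C_T}` is `dμ_{C_L}`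
(both are centred Gaussian with covariance `δ_{ab}C_T(proj x − proj y) = δ_{ab}C_L(x − y)`; uniqueness). [cite: Balaban1983Higgs3, (2.26) p.431] -/
theorem map_pullT_torusMeasure (hη : 0 < η) (hM : 0 < M2) (hL : 1 ≤ L) :
    (torusMeasure d N L η M2).map (pullT L) = periodicMeasure d N L η M2 := by
  haveI := isProbabilityMeasure_torusMeasure (d := d) (N := N) hη hM hL
  haveI : IsProbabilityMeasure ((torusMeasure d N L η M2).map (pullT L)) :=
    Measure.isProbabilityMeasure_map measurable_pullT.aemeasurable
  have hGT := isGaussianProcess_torusMeasure (d := d) (N := N) hη hM hL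
  refine eq_kernelMeasure_of_isGaussianProcess (isPosSemidefKernel_periodic hη hM hL) ⟨fun I => ⟨?_⟩⟩ (fun p => ?_) fun p q => ?_
  · have hmeas : Measurable fun ω : Cfg d N => I.restrict fun x => ω x :=
      measurable_pi_lambda _ fun i => measurable_pi_apply _
    rw [Measure.map_map hmeas measurable_pullT]
    exact ((hGT.comp_right fun p : Idx d N => ((proj L p.1, p.2) : TIdx d N L)).hasGaussianLaw I).isGaussian_map
  · rw [integral_map measurable_pullT.aemeasurable (measurable_pi_apply p).aestronglyMeasurable]
    exact integral_eval_torusMeasure hη hM hL _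
  · rw [covariance_map (measurable_pi_apply p).aestronglyMeasurable (measurable_pi_apply q).aestronglyMeasurable
      measurable_pullT.aemeasurable]
    have hp : (fun ω : Cfg d N => ω p) ∘ pullT L = fun ωT : TCfg d N L => ωT (proj L p.1, p.2) := rfl
    have hq : (fun ω : Cfg d N => ω q) ∘ pullT L = fun ωT : TCfg d N L => ωT (proj L q.1, q.2) := rfl
    rw [hp, hq, covariance_eval_torusMeasure hη hM hL, torusKernel_apply, scalarKernel_apply]
    simp only [← proj_sub, CT_proj]

end Measures

/-! ## §4 *"They hold for free boundary conditions also by taking a limit of the identities with periodic boundary conditions"*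
(p. 431) FOR THE GAUSSIAN LEFT MEMBERS: the left member of (2.26) under the `L`-periodic field `dμ_{C_L}` is a torus Gaussian
integral, vanishes for every large period, and converges to the left member under `dμ_{C^η_{M²}}` as `L → ∞` -/

section Limit

variable (C : HiggsLattice.ChargeData N) (η : ℝ) {M2 : ℝ}

/-- the printed integrand of (2.26): `(−e⟨∂^ηφ,Bqφ⟩)(:⟨∂^ηφ,∂^ηλqφ⟩:) − e⟨φ,B·∂^ηλq²φ⟩ − eη⟨∂^ηφ,B∂^ηλq²φ⟩`, the normal ordering
taken with respect to the measure `μ`. [cite: Balaban1983Higgs3, (2.26) p.431] -/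
def integrand226 (μ : Measure (Cfg d N)) (S : Finset (ZSite d)) (B : ZSite d → Fin d → ℝ) (lam : ZSite d → ℝ) (ω : Cfg d N) : ℝ :=
  (-C.e * curJ C η S B ω) * normOrd μ (pairD C η S lam) ω - C.e * locQ C η S B lam ω - (η * C.e) * derQ C η S B lam ω

/-- **the Gaussian left member of (2.26)** under a measure `μ` on the configurations of `ηℤ^d`: `∫ integrand226 dμ`.
[cite: Balaban1983Higgs3, (2.26) p.431] -/
def lhs226 (μ : Measure (Cfg d N)) (S : Finset (ZSite d)) (B : ZSite d → Fin d → ℝ) (lam : ZSite d → ℝ) : ℝ :=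
  ∫ ω, integrand226 C η μ S B lam ω ∂μ

/-- the integrand of (2.26) is measurable. [cite: Balaban1983Higgs3, (2.26) p.431] -/
@[fun_prop]
theorem measurable_integrand226 (μ : Measure (Cfg d N)) (S : Finset (ZSite d)) (B : ZSite d → Fin d → ℝ) (lam : ZSite d → ℝ) :
    Measurable (integrand226 C η μ S B lam) := by
  unfold integrand226 normOrd
  exact ((((measurable_curJ C η S B).const_mul _).mul ((measurable_pairD C η S lam).sub_const _)).sub
    ((measurable_locQ C η S B lam).const_mul _)).sub ((measurable_derQ C η S B lam).const_mul _)

/-- at free boundary conditions `lhs226` is the Gaussian integral of `B3WT226FreeGaussian` (definitional). [cite: Balaban1983Higgs3, (2.26) p.431] -/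
theorem lhs226_free_eq (S : Finset (ZSite d)) (B : ZSite d → Fin d → ℝ) (lam : ZSite d → ℝ) :
    lhs226 C η (freeMeasure d N η M2) S B lam =
      ∫ ω, ((-C.e * curJ C η S B ω) * normOrd (freeMeasure d N η M2) (pairD C η S lam) ω - C.e * locQ C η S B lam ω
        - (η * C.e) * derQ C η S B lam ω) ∂freeMeasure d N η M2 := rfl

variable [NeZero L]

/-- **(2.25) WITH PERIODIC BOUNDARY CONDITIONS, read on `ℤ^d`**: `∫dμ_{C_L}⟨∂^ηφ, ∂^ηλqφ⟩ = 0` for every period `L ≥ 1`.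
[cite: Balaban1983Higgs3, (2.25) p.431] -/
theorem eq225_periodic (hη : 0 < η) (hM : 0 < M2) (hL : 1 ≤ L) (S : Finset (ZSite d)) (lam : ZSite d → ℝ) :
    ∫ ω, pairD C η S lam ω ∂periodicMeasure d N L η M2 = 0 :=
  eq225_freeK C η (Cv := perC L (CetaM d η M2)) (isPosSemidefKernel_periodic hη hM hL) S lam

/-- **the periodic identities ARE torus Gaussian integrals**: the left member of (2.26) under `dμ_{C_L}` is the integral of the
printed integrand, read through `proj`, against the torus measure `dμ_{C_T}` of period `L`. [cite: Balaban1983Higgs3, (2.26) p.431] -/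
theorem lhs226_periodic_eq_integral_torus (hη : 0 < η) (hM : 0 < M2) (hL : 1 ≤ L) (S : Finset (ZSite d))
    (B : ZSite d → Fin d → ℝ) (lam : ZSite d → ℝ) :
    lhs226 C η (periodicMeasure d N L η M2) S B lam =
      ∫ ωT, integrand226 C η (periodicMeasure d N L η M2) S B lam (pullT L ωT) ∂torusMeasure d N L η M2 := by
  rw [lhs226, ← map_pullT_torusMeasure hη hM hL,
    integral_map measurable_pullT.aemeasurable (measurable_integrand226 C η _ S B lam).aestronglyMeasurable]

/-- **the Gaussian left member of (2.26) under `dμ_{C_L}` evaluated**: `= eΣ_bη^dB_b tr q²·bracket226 η C_L λ b` (Wick's theorem for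
the periodic field; `∂^ηλ` supported in the bonds based in the window). [cite: Balaban1983Higgs3, (2.26) p.431] -/
theorem lhs226_periodic_eq (hη : 0 < η) (hM : 0 < M2) (hL : 1 ≤ L) (S : Finset (ZSite d)) (B : ZSite d → Fin d → ℝ)
    (lam : ZSite d → ℝ) (hlamS : ∀ x, x ∉ S → ∀ ν : Fin d, pdiffZ η⁻¹ ν lam x = 0) :
    lhs226 C η (periodicMeasure d N L η M2) S B lam =
      C.e * ∑ x ∈ S, ∑ μ : Fin d, η ^ d * B x μ * (trE (C.q.comp C.q) * bracket226 η (perC L (CetaM d η M2)) lam x μ) :=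
  eq226_free_wick_bracketK C η (Cv := perC L (CetaM d η M2)) (isPosSemidefKernel_periodic hη hM hL) (perC_neg CetaM_neg L)
    S B lam hlamS

omit [NeZero L] in
/-- the Gaussian left member of (2.26) under `dμ_{C^η_{M²}}` evaluated (file `B3WT226FreeGaussian`). [cite: Balaban1983Higgs3, (2.26) p.431] -/
theorem lhs226_free_eq_bracket (hη : 0 < η) (hM : 0 < M2) (S : Finset (ZSite d)) (B : ZSite d → Fin d → ℝ)
    (lam : ZSite d → ℝ) (hlamS : ∀ x, x ∉ S → ∀ ν : Fin d, pdiffZ η⁻¹ ν lam x = 0) :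
    lhs226 C η (freeMeasure d N η M2) S B lam =
      C.e * ∑ x ∈ S, ∑ μ : Fin d, η ^ d * B x μ * (trE (C.q.comp C.q) * bracket226 η (CetaM d η M2) lam x μ) :=
  eq226_free_wick_bracket C η hη hM S B lam hlamS

end Limit

section LimitTheorems

variable (C : HiggsLattice.ChargeData N) (η : ℝ) {M2 : ℝ}

/-- **THE IDENTITIES WITH PERIODIC BOUNDARY CONDITIONS**: for a finitely supported gauge function (support `T`, window
`S ⊇ T ∪ ⋃_ν(T − e_ν)`), the Gaussian left member of (2.26) under the `L`-periodic field `dμ_{C_L}` VANISHES FOR EVERY PERIOD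
`L ≥ L₀` (the torus identities of `B3WT226PeriodicKernel`/`B3WT226PeriodicLimit` for the periodized propagator, once the torus is
larger than the diameter of the data). [cite: Balaban1983Higgs3, (2.26) p.431] -/
theorem lhs226_periodic_eq_zero (hη : 0 < η) (hM : 0 < M2) (T S : Finset (ZSite d)) (B : ZSite d → Fin d → ℝ)
    (lam : ZSite d → ℝ) (hT : ∀ x, x ∉ T → lam x = 0) (hTS : T ⊆ S) (hTS' : ∀ ν : Fin d, ∀ x ∈ T, x - unitVec ν ∈ S) {L : ℕ}
    [NeZero L] (hL : 2 + 2 * S.sup (fun x => (bigT T x).sup fun z => l1 z) ≤ L) :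
    lhs226 C η (periodicMeasure d N L η M2) S B lam = 0 := by
  rw [lhs226_periodic_eq C η hη hM (by omega) S B lam (pdiffZ_eq_zero_off_window η hT hTS hTS')]
  refine mul_eq_zero_of_right _ (Finset.sum_eq_zero fun x hx => Finset.sum_eq_zero fun μ _ => ?_)
  have hx' : (bigT T x).sup (fun z => l1 z) ≤ S.sup (fun x => (bigT T x).sup fun z => l1 z) :=
    Finset.le_sup (f := fun x => (bigT T x).sup fun z => l1 z) hx
  rw [bracket226_eq_bracketFin hT, bracketFin_perC_eq_zero (m := 1) hη CetaM_neg (negLapZ_CetaM_add hη hM)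
    (summable_weight_CetaM hη hM 1) hT x μ (by omega) (by omega), mul_zero, mul_zero]

/-- **THE LIMIT `L → ∞` OF THE GAUSSIAN LEFT MEMBERS**: the left member of (2.26) under the `L`-periodic field `dμ_{C_L}` converges
to the left member under the infinite-volume measure `dμ_{C^η_{M²}}` (both are `eΣ_bη^dB_b tr q²·bracket`, a fixed polynomial in
finitely many propagator values, and `C_L → C^η_{M²}` pointwise, `B3WT226PeriodicLimit.tendsto_perC`).
[cite: Balaban1983Higgs3, (2.26) p.431] -/
theorem tendsto_lhs226_periodic (hη : 0 < η) (hM : 0 < M2) (T S : Finset (ZSite d)) (B : ZSite d → Fin d → ℝ)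
    (lam : ZSite d → ℝ) (hT : ∀ x, x ∉ T → lam x = 0) (hTS : T ⊆ S) (hTS' : ∀ ν : Fin d, ∀ x ∈ T, x - unitVec ν ∈ S) :
    Tendsto (fun L : ℕ => lhs226 C η (periodicMeasure d N (L + 1) η M2) S B lam) atTop
      (𝓝 (lhs226 C η (freeMeasure d N η M2) S B lam)) := by
  have hlamS := pdiffZ_eq_zero_off_window η hT hTS hTS'
  have hev : ∀ L : ℕ, lhs226 C η (periodicMeasure d N (L + 1) η M2) S B lam = C.e * ∑ x ∈ S, ∑ μ : Fin d,
      η ^ d * B x μ * (trE (C.q.comp C.q) * bracketFin (dSupp T) η (perC (L + 1) (CetaM d η M2)) lam x μ) := by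
    intro L
    rw [lhs226_periodic_eq C η hη hM (by omega) S B lam hlamS]
    simp_rw [bracket226_eq_bracketFin hT]
  rw [lhs226_free_eq_bracket C η hη hM S B lam hlamS]
  simp_rw [hev, bracket226_eq_bracketFin hT]
  refine Tendsto.const_mul _ (tendsto_finsetSum _ fun x _ => tendsto_finsetSum _ fun μ _ => ?_)
  refine Tendsto.const_mul _ (Tendsto.const_mul _ ?_)
  exact (tendsto_bracketFin (m := 1) (summable_weight_CetaM hη hM 1) le_rfl (dSupp T) η lam x μ).comp (tendsto_add_atTop_nat 1)

/-- **(2.26) AT FREE BOUNDARY CONDITIONS "BY TAKING A LIMIT OF THE IDENTITIES WITH PERIODIC BOUNDARY CONDITIONS"** (p. 431, for the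
GAUSSIAN LEFT MEMBER, literally): the left member under `dμ_{C^η_{M²}}` is the `L → ∞` limit of the left members under the periodic
fields `dμ_{C_L}`, each of which vanishes for `L` large; hence it vanishes. (`B3WT226FreeGaussian.eq226_free_gaussian_of_support`
is the direct evaluation.) [cite: Balaban1983Higgs3, (2.26) p.431] -/
theorem lhs226_free_eq_zero_of_periodic_limit (hη : 0 < η) (hM : 0 < M2) (T S : Finset (ZSite d))
    (B : ZSite d → Fin d → ℝ) (lam : ZSite d → ℝ) (hT : ∀ x, x ∉ T → lam x = 0) (hTS : T ⊆ S)
    (hTS' : ∀ ν : Fin d, ∀ x ∈ T, x - unitVec ν ∈ S) : lhs226 C η (freeMeasure d N η M2) S B lam = 0 := by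
  have hlim := tendsto_lhs226_periodic C η hη hM T S B lam hT hTS hTS'
  have hev : ∀ᶠ L : ℕ in atTop, lhs226 C η (periodicMeasure d N (L + 1) η M2) S B lam = 0 :=
    eventually_atTop.2 ⟨2 + 2 * S.sup (fun x => (bigT T x).sup fun z => l1 z), fun L hL =>
      lhs226_periodic_eq_zero C η hη hM T S B lam hT hTS hTS' (by omega)⟩
  exact tendsto_nhds_unique hlim (tendsto_const_nhds.congr' (hev.mono fun L hL => hL.symm))

end LimitTheorems

/-! ## §5 The measure-level limit: ALL FINITE-DIMENSIONAL MARGINALS of the periodic fields `dμ_{C_L}` CONVERGE WEAKLY to those of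
`dμ_{C^η_{M²}}` as `L → ∞` (centred Gaussians with converging covariances; Lévy's continuity theorem) -/

section Marginals

variable {ι : Type} [DecidableEq ι] {K : ι → ι → ℝ}

/-- the law of the coordinates in a finite window `I`, as a measure on `EuclideanSpace ℝ I`. [cite: Kallenberg2002, Lemma 13.1] -/
def marginalLaw (μ : Measure (ι → ℝ)) (I : Finset ι) : Measure (EuclideanSpace ℝ I) :=
  (μ.map I.restrict).map (MeasurableEquiv.toLp 2 (I → ℝ))

omit [DecidableEq ι] in
/-- the marginal law of a probability measure is a probability measure. [cite: Kallenberg2002, Lemma 13.1] -/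
theorem isProbabilityMeasure_marginalLaw (μ : Measure (ι → ℝ)) [IsProbabilityMeasure μ] (I : Finset ι) :
    IsProbabilityMeasure (marginalLaw μ I) := by
  haveI : IsProbabilityMeasure (μ.map I.restrict) :=
    Measure.isProbabilityMeasure_map (Finset.measurable_restrict I).aemeasurable
  exact Measure.isProbabilityMeasure_map (MeasurableEquiv.toLp 2 (I → ℝ)).measurable.aemeasurable

/-- **the marginals of the Gaussian field of a positive semidefinite kernel are the centred multivariate Gaussians `N(0, (K(s,t))_{s,t∈I})`**.
[cite: Kallenberg2002, Lemma 13.1] -/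
theorem marginalLaw_gaussianFieldOfKernel (hK : IsPosSemidefKernel K) (I : Finset ι) :
    marginalLaw (gaussianFieldOfKernel K) I = multivariateGaussian 0 (covGram K I) := by
  unfold marginalLaw
  rw [gaussianFieldOfKernel_map_restrict hK I, gaussianFamilyOfKernel,
    Measure.map_map (MeasurableEquiv.toLp 2 (I → ℝ)).measurable (MeasurableEquiv.toLp 2 (I → ℝ)).symm.measurable,
    MeasurableEquiv.self_comp_symm, Measure.map_id]

end Marginals

section MarginalLimit

variable {η M2 : ℝ}

/-- the characteristic functions of the window marginals of `dμ_{C_{L+1}}` converge to those of `dμ_{C^η_{M²}}` (`C_L → C^η_{M²}`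
pointwise, `B3WT226PeriodicLimit.tendsto_perC`). [cite: Balaban1983Higgs3, (2.26) p.431] -/
theorem tendsto_charFun_marginalLaw_periodic (hη : 0 < η) (hM : 0 < M2) (I : Finset (Idx d N)) (t : EuclideanSpace ℝ I) :
    Tendsto (fun L : ℕ => charFun (marginalLaw (periodicMeasure d N (L + 1) η M2) I) t) atTop
      (𝓝 (charFun (marginalLaw (freeMeasure d N η M2) I) t)) := by
  have hKL : ∀ L : ℕ, IsPosSemidefKernel (scalarKernel d N (perC (L + 1) (CetaM d η M2))) := fun L =>
    isPosSemidefKernel_periodic hη hM (by omega)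
  have hK := isPosSemidefKernel_freeKernel (d := d) (N := N) hη hM
  have hL : ∀ L : ℕ, charFun (marginalLaw (periodicMeasure d N (L + 1) η M2) I) t =
      Complex.exp (-(((t : I → ℝ) ⬝ᵥ covGram (scalarKernel d N (perC (L + 1) (CetaM d η M2))) I *ᵥ (t : I → ℝ) : ℝ) : ℂ) / 2) := by
    intro L
    rw [periodicMeasure, kernelMeasure, marginalLaw_gaussianFieldOfKernel (hKL L), charFun_multivariateGaussian (hKL L I)]
    simp
    ring_nf
  have h0 : charFun (marginalLaw (freeMeasure d N η M2) I) t =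
      Complex.exp (-(((t : I → ℝ) ⬝ᵥ covGram (freeKernel d N η M2) I *ᵥ (t : I → ℝ) : ℝ) : ℂ) / 2) := by
    rw [freeMeasure, marginalLaw_gaussianFieldOfKernel hK, charFun_multivariateGaussian (hK I)]
    simp
    ring_nf
  simp_rw [hL, h0]
  refine ((Complex.continuous_exp.tendsto _).comp <| Tendsto.div_const (Tendsto.neg <|
    (Complex.continuous_ofReal.tendsto _).comp ?_) 2)
  simp only [dotProduct, Matrix.mulVec, covGram_apply, scalarKernel_apply, freeKernel_apply]
  refine tendsto_finsetSum _ fun s _ => Tendsto.const_mul _ (tendsto_finsetSum _ fun s' _ => Tendsto.mul_const _ ?_)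
  split_ifs
  · exact (tendsto_perC (m := 1) (summable_weight_CetaM hη hM 1) le_rfl _).comp (tendsto_add_atTop_nat 1)
  · exact tendsto_const_nhds

/-- the window-`I` marginal of the periodic field `dμ_{C_{L+1}}` as a probability measure on `EuclideanSpace ℝ I`.
[cite: Balaban1983Higgs3, (2.26) p.431] -/
def marginalPeriodic (hη : 0 < η) (hM : 0 < M2) (I : Finset (Idx d N)) (L : ℕ) : ProbabilityMeasure (EuclideanSpace ℝ I) :=
  ⟨marginalLaw (periodicMeasure d N (L + 1) η M2) I,
    @isProbabilityMeasure_marginalLaw _ _ (isProbabilityMeasure_periodicMeasure (d := d) (N := N) hη hM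
      (by omega : 1 ≤ L + 1)) I⟩

/-- the window-`I` marginal of the free field `dμ_{C^η_{M²}}` as a probability measure on `EuclideanSpace ℝ I`.
[cite: Balaban1983Higgs3, (2.26) p.431] -/
def marginalFree (hη : 0 < η) (hM : 0 < M2) (I : Finset (Idx d N)) : ProbabilityMeasure (EuclideanSpace ℝ I) :=
  ⟨marginalLaw (freeMeasure d N η M2) I, @isProbabilityMeasure_marginalLaw _ _ (isProbabilityMeasure_freeMeasure hη hM) I⟩

/-- unfolding. [cite: Balaban1983Higgs3, (2.26) p.431] -/
@[simp] theorem coe_marginalPeriodic (hη : 0 < η) (hM : 0 < M2) (I : Finset (Idx d N)) (L : ℕ) :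
    ((marginalPeriodic (d := d) (N := N) hη hM I L : ProbabilityMeasure (EuclideanSpace ℝ I)) : Measure (EuclideanSpace ℝ I)) =
      marginalLaw (periodicMeasure d N (L + 1) η M2) I := rfl

/-- unfolding. [cite: Balaban1983Higgs3, (2.26) p.431] -/
@[simp] theorem coe_marginalFree (hη : 0 < η) (hM : 0 < M2) (I : Finset (Idx d N)) :
    ((marginalFree (d := d) (N := N) hη hM I : ProbabilityMeasure (EuclideanSpace ℝ I)) : Measure (EuclideanSpace ℝ I)) =
      marginalLaw (freeMeasure d N η M2) I := rfl

/-- **THE PERIODIC GAUSSIAN FIELDS CONVERGE TO THE FREE ONE IN THE SENSE OF FINITE-DIMENSIONAL DISTRIBUTIONS**: for every finite window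
`I ⊂ ℤ^d × {1,…,N}` the law of `(φ_a(x))_{(x,a)∈I}` under `dμ_{C_{L+1}}` converges weakly, as `L → ∞`, to its law under `dμ_{C^η_{M²}}`
(Lévy's continuity theorem) — the measure-level content of *"a limit of … periodic boundary conditions"*. [cite: Balaban1983Higgs3, (2.26) p.431] -/
theorem tendsto_marginal_periodic (hη : 0 < η) (hM : 0 < M2) (I : Finset (Idx d N)) :
    Tendsto (marginalPeriodic (d := d) (N := N) hη hM I) atTop (𝓝 (marginalFree hη hM I)) := by
  refine ProbabilityMeasure.tendsto_of_tendsto_charFun fun t => ?_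
  simp only [coe_marginalPeriodic, coe_marginalFree]
  exact tendsto_charFun_marginalLaw_periodic hη hM I t

end MarginalLimit

end Literature.MathematicalPhysics.QuantumFieldTheory.Balaban1983to89.B3WTPeriodicMeasure

end
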